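import Summits.CriticalPhenomena.CardyFormulaZ2.Theorems.CardySelfDualSegmentUniformBoxCrossingDefs2
import Literature.Probability.Percolation.LowestCrossingInterface
import HarnessLib

/-!
# Stub `stub_explore` (crux stmt-CriticalPhenomena-5476 `UniformBoxCrossing`, line `Sketch`):
# the exploration API — winding-number bridge and locality of the explored face sets

Two deterministic facts about the explorations of the two stacked squares of Bollobás–Riordan
(2010, arXiv:1001.4674, §5.1, proof of Thm. 5.3), in the vocabulary of
`…UniformBoxCrossingDefs.lean` / `…UniformBoxCrossingDefs2.lean`:

* `bridge_holds : BridgeStatement` — **the winding-number bridge.** For an interface walk `w` of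
  the lower hull of `[0, n]²` (a square crossing all of whose edges are boundary edges of
  `lowerHull n ω`), the extended walk `P̂ = extendRight w.walk 0` winds `-1` times around every
  hull face and `0` times around every other face of the dual square. Faces of `dualBelow n ω`
  are handled by `IsSquareCrossing.walkWinding_ext_of_mem`; a face off the hull is top-free, and
  the winding number is constant along the face walk joining it to a top face (no separating
  edge of two non-hull faces is an edge of `P̂`, `sepEdge_notMem_edges_ext`), where it vanishes
  (`walkWinding_ext_eq_zero`); a hull face not in `dualBelow n ω` has the face below it in the
  hull (`sub_single_one_mem_lowerHull`), with the same winding number, so induction on the height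
  concludes.
* `examined_holds : ExaminedStatement` — **locality of the explorations in the corner coins.**
  Coin configurations agreeing on `examinedCoins n s S` have the same lower explored set
  `dualBelow n (cornerConfig ·)` and the same upper explored set `dualAbove n s (cornerConfig ·)`:
  the state of a lattice edge `e` in `cornerConfig S` is a function of the two coins at
  `cornerOf e` (`mem_cornerConfig_iff_of_forall`), the edges bounding the explored faces have
  their corners in the zones, and `dualBelow_eq_of_inter_eq` (locality of `{dualBelow = D₀}`)
  applies — for the upper square after transporting through the reflection `upperRefl n s`
  (`dualEdge_map_reflY`).
* `stub_explore` — the registered conjunction.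

## References

* B. Bollobás, O. Riordan, *Percolation on self-dual polygon configurations*, Bolyai Soc. Math.
  Stud. 21 (2010) 131–217, arXiv:1001.4674, §5.1 (proof of Thm. 5.3). [BollobasRiordan2010]
* H. Kesten, *Percolation theory for mathematicians*, Birkhäuser (1982), §2.2–2.3. [KestenPTM1982]
-/

noncomputable section

namespace Summit.CriticalPhenomena.CardyFormulaZ2.Cruxes.UniformBoxCrossing.NonSlantLine

open SimpleGraph Finset Literature.Probability.Percolation Literature.Probability.LatticeModels

/-! ### (a) The winding-number bridge -/

section Bridge

variable {n : ℕ} {ω : BondConfig (Site 2)}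

/-- Below a hull face that is not explored lies a hull face: if `f ∈ lowerHull n ω` and
`f ∉ dualBelow n ω`, then `f - e₁` is a face of the dual square (as `f` is not a bottom face)
and it is not top-free (else so would be `f`, one free step above it). [folklore] -/
theorem sub_single_one_mem_lowerHull {f : Site 2} (hf : f ∈ lowerHull n ω)
    (hfD : f ∉ dualBelow n ω) : f - Pi.single 1 1 ∈ lowerHull n ω := by
  obtain ⟨hfR, hfT⟩ := (mem_lowerHull_iff n).1 hf
  have hR := mem_dualRectangle_iff.1 hfR
  have hf1 : f 1 ≠ -1 := fun h1 =>
    hfD (mem_dualBelow_of_mem_dualBottomSide (Finset.mem_filter.2 ⟨hfR, h1⟩))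
  have hgR : f - Pi.single 1 1 ∈ dualRectangle n n := by
    simp only [mem_dualRectangle_iff, Pi.sub_apply, single_one_apply_zero, single_one_apply_one]
    omega
  refine (mem_lowerHull_iff n).2 ⟨hgR, ?_⟩
  rintro ⟨t, ht, g, hg, hconn⟩
  rw [Set.mem_singleton_iff] at hg
  subst hg
  have hgS : f - Pi.single 1 1 ∈ (↑(dualRectangle n n) : Set (Site 2)) \ ↑(dualBelow n ω) := by
    obtain ⟨-, hy, -⟩ := hconn
    exact hy
  have hadj : (zdGraph 2).Adj (f - Pi.single 1 1) f := (adj_sub_single_one f).symm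
  exact hfT ⟨t, ht, f, rfl, PlanarDuality.openConnIn_trans hconn
    (openConnIn_of_adj hgS ⟨Finset.mem_coe.2 hfR, hfD⟩ ((zdGraph 2).mem_edgeSet.2 hadj) hadj.ne)⟩

variable {w : XWalk} (hsq : IsSquareCrossing n w.walk)
  (hbd : ∀ d ∈ w.walk.darts, IsBdryEdge (lowerHull n ω) n d.edge)
include hsq hbd

/-- **No edge of `P̂` separates two hull faces or two non-hull faces.** If `g`, `g'` are adjacent
faces of the dual square, both in the lower hull or both outside it, then the lattice edge
between them is not an edge of `P̂ = extendRight w.walk 0`: the edges of `w` are boundary edges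
of the hull (their dual joins a hull face to a non-hull face, `dualEdge_sepEdge`), and the other
edges of `P̂` have an endpoint on the column `x₀ = n + 1`, outside the dual square. [folklore] -/
theorem sepEdge_notMem_edges_ext {g g' : Site 2} (hadj : (zdGraph 2).Adj g g')
    (hg : g ∈ dualRectangle n n) (hg' : g' ∈ dualRectangle n n)
    (hiff : (g ∈ lowerHull n ω ↔ g' ∈ lowerHull n ω)) :
    sepEdge g g' ∉ (extendRight w.walk 0).edges := by
  intro hmem
  rcases mem_edges_extendRight hmem with hπ | ⟨v, hv, hv0⟩
  · obtain ⟨d, hd, hde⟩ : ∃ d ∈ w.walk.darts, d.edge = sepEdge g g' := by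
      rw [Walk.edges] at hπ
      exact List.mem_map.1 hπ
    have hb := hbd d hd
    rw [hde] at hb
    obtain ⟨g₁, g₁', hde', -, -, hg₁, hg₁'⟩ := hb
    rw [dualEdge_sepEdge hadj] at hde'
    rcases Sym2.eq_iff.1 hde' with ⟨h1, h2⟩ | ⟨h1, h2⟩
    · subst h1 h2
      exact hg₁' (hiff.1 hg₁)
    · subst h1 h2
      exact hg₁' (hiff.2 hg₁)
  · have h1 := (sepEdge_apply_zero_le hv).1
    have hmax : max (g 0) (g' 0) ≤ (n : ℤ) - 1 :=
      max_le (mem_dualRectangle_iff.1 hg).2.1 (mem_dualRectangle_iff.1 hg').2.1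
    rw [hsq.finish] at hv0
    omega

/-- **Off the hull the winding number vanishes.** A face of the dual square outside the lower hull
is top-free: it is joined to a top face `t` by a walk of faces of the dual square avoiding
`dualBelow n ω`, all of which are top-free, hence off the hull; so `P̂` crosses none of the
separating edges along this walk (`sepEdge_notMem_edges_ext`), its winding number is constant
along it (`walkWinding_eq_of_faceWalk`), and it vanishes at `t` (height `n`,
`walkWinding_ext_eq_zero`). [cite: BollobasRiordan2010, §5.1 proof of Thm. 5.3] -/
theorem walkWinding_ext_eq_zero_of_notMem_lowerHull {f : Site 2} (hf : f ∈ dualRectangle n n)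
    (hfH : f ∉ lowerHull n ω) : walkWinding (extendRight w.walk 0) f = 0 := by
  have hfree : TopFree n (dualBelow n ω) f := by
    by_contra h
    exact hfH ((mem_lowerHull_iff n).2 ⟨hf, h⟩)
  obtain ⟨t, ht, f', hf', hconn⟩ := hfree
  rw [Set.mem_singleton_iff] at hf'
  subst hf'
  obtain ⟨q, hqS, -⟩ := exists_walk_of_mem_openConnIn (G := zdGraph 2) subset_rfl hconn
  have hqR : ∀ z ∈ q.support, z ∈ dualRectangle n n := fun z hz => Finset.mem_coe.1 (hqS z hz).1
  -- every face on `q` is top-free, hence off the hull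
  have hqH : ∀ z ∈ q.support, z ∉ lowerHull n ω := by
    intro z hz hzH
    refine ((mem_lowerHull_iff n).1 hzH).2 ⟨t, ht, z, rfl, ?_⟩
    exact mem_openConnIn_of_mem_support q hqS (fun e he => q.edges_subset_edgeSet he) hz
  have ht1 : (n : ℤ) ≤ t 1 := le_of_eq (Finset.mem_filter.1 (Finset.mem_coe.1 ht)).2.symm
  refine (walkWinding_eq_of_faceWalk _ q (fun dq hdq => ?_)
    (fun z hz => hsq.start_notMem_rayAbove' (mem_dualRectangle_iff.1 (hqR z hz)).1)
    (fun z hz => hsq.ext_end_notMem_rayAbove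
      (by have := (mem_dualRectangle_iff.1 (hqR z hz)).2.2.1; omega))).symm.trans
    (hsq.walkWinding_ext_eq_zero ht1)
  exact sepEdge_notMem_edges_ext hsq hbd dq.adj (hqR _ (q.dart_fst_mem_support_of_mem_darts hdq))
    (hqR _ (q.dart_snd_mem_support_of_mem_darts hdq))
    (iff_of_false (hqH _ (q.dart_fst_mem_support_of_mem_darts hdq))
      (hqH _ (q.dart_snd_mem_support_of_mem_darts hdq)))

/-- **On the hull the winding number is `-1`.** The faces of `dualBelow n ω` have winding number
`-1` (`IsSquareCrossing.walkWinding_ext_of_mem`: the edges of `w` are boundary edges of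
`dualBelow n ω` too, `isBdryEdge_dualBelow_of_isBdryEdge_lowerHull`); a hull face not in
`dualBelow n ω` has the face below it in the hull (`sub_single_one_mem_lowerHull`) with the same
winding number (the edge between them is not an edge of `P̂`, `sepEdge_notMem_edges_ext`):
induction on the height. [cite: BollobasRiordan2010, §5.1 proof of Thm. 5.3] -/
theorem walkWinding_ext_of_mem_lowerHull {f : Site 2} (hf : f ∈ lowerHull n ω) :
    walkWinding (extendRight w.walk 0) f = -1 := by
  have hbdD : ∀ d ∈ w.walk.darts, IsBdryEdge (dualBelow n ω) n d.edge := fun d hd =>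
    isBdryEdge_dualBelow_of_isBdryEdge_lowerHull n d.edge_mem (hbd d hd)
  have hD : ∀ g ∈ dualBelow n ω, walkWinding (extendRight w.walk 0) g = -1 := fun g hg =>
    hsq.walkWinding_ext_of_mem hbdD rfl hg
  obtain ⟨m, hm⟩ : ∃ m : ℕ, f 1 + 1 = m := by
    have := (mem_dualRectangle_iff.1 ((mem_lowerHull_iff n).1 hf).1).2.2.1
    exact ⟨(f 1 + 1).toNat, (Int.toNat_of_nonneg (by omega)).symm⟩
  induction m generalizing f with
  | zero =>
    refine hD f (mem_dualBelow_of_mem_dualBottomSide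
      (Finset.mem_filter.2 ⟨((mem_lowerHull_iff n).1 hf).1, ?_⟩))
    omega
  | succ m ih =>
    by_cases hfD : f ∈ dualBelow n ω
    · exact hD f hfD
    have hfR : f ∈ dualRectangle n n := ((mem_lowerHull_iff n).1 hf).1
    have hR := mem_dualRectangle_iff.1 hfR
    have hf1 : f 1 ≠ -1 := fun h1 =>
      hfD (mem_dualBelow_of_mem_dualBottomSide (Finset.mem_filter.2 ⟨hfR, h1⟩))
    have hg : f - Pi.single 1 1 ∈ lowerHull n ω := sub_single_one_mem_lowerHull hf hfD
    have hgR : f - Pi.single 1 1 ∈ dualRectangle n n := ((mem_lowerHull_iff n).1 hg).1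
    have ihg : walkWinding (extendRight w.walk 0) (f - Pi.single 1 1) = -1 :=
      ih hg (by simp only [Pi.sub_apply, single_one_apply_one]; omega)
    rw [← ihg]
    -- the edge between `f - e₁` and `f` is not an edge of `P̂`
    have hadj : (zdGraph 2).Adj (f - Pi.single 1 1) (f - Pi.single 1 1 + Pi.single 1 1) := by
      rw [sub_add_cancel]
      exact (adj_sub_single_one f).symm
    have hne := sepEdge_notMem_edges_ext hsq hbd hadj hgR (by rw [sub_add_cancel]; exact hfR)
      (iff_of_true hg (by rw [sub_add_cancel]; exact hf))
    rw [sepEdge_up] at hne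
    have key := walkWinding_eq_walkWinding_up hne
      (hsq.start_notMem_rayAbove' (z := f - Pi.single 1 1)
        (by simp only [Pi.sub_apply, single_one_apply_zero]; omega))
      (hsq.ext_end_notMem_rayAbove (z := f - Pi.single 1 1)
        (by simp only [Pi.sub_apply, single_one_apply_one]; omega))
    rw [sub_add_cancel] at key
    exact key.symm

end Bridge

/-- **The winding-number bridge** (`BridgeStatement`): for an interface walk of the lower hull of
`[0, n]²`, the extended walk winds `-1` around every hull face and `0` around every other face
of the dual square. [cite: BollobasRiordan2010, §5.1 proof of Thm. 5.3] -/
theorem bridge_holds : BridgeStatement := fun _ _ _ _ _ hsq hbd =>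
  ⟨fun _ hf => walkWinding_ext_of_mem_lowerHull hsq hbd hf,
    fun _ hf hfH => walkWinding_ext_eq_zero_of_notMem_lowerHull hsq hbd hf hfH⟩

/-! ### (b) Locality of the explorations in the corner coins -/

section Examined

/-- The four edges bounding a face are lattice edges. [folklore] -/
theorem mem_edgeSet_of_mem_squareEdges {e : Sym2 (Site 2)} {g : Site 2} (h : e ∈ squareEdges g) :
    e ∈ (zdGraph 2).edgeSet := by
  simp only [squareEdges, Finset.mem_insert, Finset.mem_singleton] at h
  rcases h with rfl | rfl | rfl | rfl <;> exact single_edge_mem _ _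

/-- **The state of a lattice edge in the corner model is a function of the two coins at its
corner**: if the coins `(cornerOf e, 0)`, `(cornerOf e, 1)` agree in `S` and `S'`, then `e` has
the same state in `cornerConfig S` and `cornerConfig S'` (`e = cornerEdge (cornerOf e, i)`,
`cornerEdge_mem_cornerConfig_iff`). [cite: BollobasRiordan2010, §2 Cor. 2.3] -/
theorem mem_cornerConfig_iff_of_forall {S S' : Set (Site 2 × Fin 2)} {e : Sym2 (Site 2)}
    (he : e ∈ (zdGraph 2).edgeSet) (h : ∀ j : Fin 2, ((cornerOf e, j) ∈ S ↔ (cornerOf e, j) ∈ S')) :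
    (e ∈ cornerConfig S ↔ e ∈ cornerConfig S') := by
  obtain ⟨i, rfl⟩ := mem_edgeSet_iff_exists_cornerEdge.1 he
  rw [cornerOf_cornerEdge] at h
  rw [cornerEdge_mem_cornerConfig_iff, cornerEdge_mem_cornerConfig_iff]
  have : (fun j => (i.1, j) ∈ S) = (fun j => (i.1, j) ∈ S') := funext fun j => propext (h j)
  rw [this]

/-- Coins agreeing on the zone of `D` give corner configurations agreeing on `belowEdges D`.
[folklore] -/
theorem inter_belowEdges_eq_of_forall {S S' : Set (Site 2 × Fin 2)} {D : Finset (Site 2)}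
    (h : ∀ z ∈ zone D, ∀ j : Fin 2, ((z, j) ∈ S ↔ (z, j) ∈ S')) :
    cornerConfig S ∩ ↑(belowEdges D) = cornerConfig S' ∩ ↑(belowEdges D) := by
  ext e
  simp only [Set.mem_inter_iff, Finset.mem_coe]
  constructor
  · rintro ⟨he, heB⟩
    exact ⟨(mem_cornerConfig_iff_of_forall (cornerConfig_subset_edgeSet S he)
      (h _ (mem_zone_iff.2 ⟨e, heB, rfl⟩))).1 he, heB⟩
  · rintro ⟨he, heB⟩
    exact ⟨(mem_cornerConfig_iff_of_forall (cornerConfig_subset_edgeSet S' he)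
      (h _ (mem_zone_iff.2 ⟨e, heB, rfl⟩))).2 he, heB⟩

variable {n s : ℕ} {S S' : Set (Site 2 × Fin 2)}

/-- **Locality of the lower exploration**: coins agreeing on the examined coins of `S` give the
same `dualBelow n (cornerConfig ·)` (`dualBelow_eq_of_inter_eq` on `belowEdges` of the explored
set, whose corners lie in its zone). [cite: BollobasRiordan2010, §5.1 proof of Thm. 5.3] -/
theorem dualBelow_cornerConfig_eq_of_forall (h : ∀ i ∈ examinedCoins n s S, (i ∈ S ↔ i ∈ S')) :
    dualBelow n (cornerConfig S') = dualBelow n (cornerConfig S) :=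
  dualBelow_eq_of_inter_eq (inter_belowEdges_eq_of_forall fun z hz j =>
    h (z, j) ((mem_examinedCoins_iff n s).2 (Or.inl hz))) rfl

/-- **Locality of the upper exploration, reflected form**: coins agreeing on the examined coins of
`S` give the same `dualBelow n (reflConfig n s (cornerConfig ·))`. For an edge `e'` bounding a
face `g'` of this set, the reflected edge `e = e'.map (upperRefl n s)` bounds the reflected face
`reflY (n + s - 1) g' ∈ dualAbove n s (cornerConfig S)` (`dualEdge_map_reflY`), so its corner
lies in the upper zone, its coins agree, and `e' ∈ reflConfig n s (cornerConfig S) ↔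
e' ∈ reflConfig n s (cornerConfig S')` (`mem_reflConfig_iff`); conclude by
`dualBelow_eq_of_inter_eq`. [cite: BollobasRiordan2010, §5.1 proof of Thm. 5.3] -/
theorem dualBelow_reflConfig_eq_of_forall (h : ∀ i ∈ examinedCoins n s S, (i ∈ S ↔ i ∈ S')) :
    dualBelow n (reflConfig n s (cornerConfig S')) = dualBelow n (reflConfig n s (cornerConfig S)) := by
  refine dualBelow_eq_of_inter_eq ?_ rfl
  set D' := dualBelow n (reflConfig n s (cornerConfig S)) with hD'
  suffices H : ∀ e' ∈ belowEdges D',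
      (e' ∈ reflConfig n s (cornerConfig S) ↔ e' ∈ reflConfig n s (cornerConfig S')) by
    ext e'
    simp only [Set.mem_inter_iff, Finset.mem_coe]
    constructor
    · rintro ⟨he, heB⟩
      exact ⟨(H e' heB).1 he, heB⟩
    · rintro ⟨he, heB⟩
      exact ⟨(H e' heB).2 he, heB⟩
  intro e' he'B
  simp only [belowEdges, Finset.mem_biUnion] at he'B
  obtain ⟨g', hg'D, hg'⟩ := he'B
  have he'E : e' ∈ (zdGraph 2).edgeSet := mem_edgeSet_of_mem_squareEdges hg'
  rw [mem_reflConfig_iff, mem_reflConfig_iff]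
  -- the reflected edge bounds a face of the upper explored set
  have hrefl : upperRefl n s = reflY ((n : ℤ) + s) := rfl
  rw [hrefl]
  have heE : Sym2.map (reflY ((n : ℤ) + s)) e' ∈ (zdGraph 2).edgeSet :=
    (map_reflY_mem_edgeSet_iff _ _).2 he'E
  have hge : reflY ((n : ℤ) + s - 1) g' ∈ dualEdge (Sym2.map (reflY ((n : ℤ) + s)) e') := by
    rw [dualEdge_map_reflY _ he'E]
    exact Sym2.mem_map.2 ⟨g', mem_dualEdge_of_mem_squareEdges hg', rfl⟩
  have hgD₂ : reflY ((n : ℤ) + s - 1) g' ∈ dualAbove n s (cornerConfig S) :=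
    Finset.mem_image_of_mem _ hg'D
  have heB : Sym2.map (reflY ((n : ℤ) + s)) e' ∈ belowEdges (dualAbove n s (cornerConfig S)) :=
    mem_belowEdges heE hgD₂ hge
  exact mem_cornerConfig_iff_of_forall heE fun j => h (_, j)
    ((mem_examinedCoins_iff n s).2 (Or.inr (mem_zone_iff.2 ⟨_, heB, rfl⟩)))

/-- **Locality of the explorations** (`ExaminedStatement`): coins agreeing on the examined coins
of `S` give the same lower and upper explored face sets. [cite: BollobasRiordan2010, §5.1 proof of Thm. 5.3] -/
theorem examined_holds : ExaminedStatement := by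
  intro n s S S' h
  refine ⟨dualBelow_cornerConfig_eq_of_forall h, ?_⟩
  unfold dualAbove
  rw [dualBelow_reflConfig_eq_of_forall h]

end Examined

/-! ### The registered stub -/

/-- **Stub `stub_explore` (exploration API)**: (a) the winding-number bridge between the lower
hull and the toolkit of `LowestCrossingInterface.lean`; (b) coins agreeing on the examined coins
give the same explored face sets. [cite: BollobasRiordan2010, §5.1 proof of Thm. 5.3] -/
theorem stub_explore : BridgeStatement ∧ ExaminedStatement := ⟨bridge_holds, examined_holds⟩

end Summit.CriticalPhenomena.CardyFormulaZ2.Cruxes.UniformBoxCrossing.NonSlantLine
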